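import Summits.QuantumFields.YangMills.Theorems.UnitScaleTiltProp7ChartSigmaT3
import Literature.MathematicalPhysics.QuantumFieldTheory.Balaban1983to89.B7TranslationCovariance
import Literature.MathematicalPhysics.QuantumFieldTheory.Balaban1983to89.B8Eq178Averages
import HarnessLib

/-!
# `UnitScaleTiltProp7ChartSigmaT3Descent` — (σ-desc), FIRST HALF: THE (81)-NORMALISED AXIAL GAUGE FIXING `glev` OF [Balaban1985Averaging] §C IS
# PERIODIC FOR PERIODIC DATA (translation covariance of (76)–(87) + print's uniqueness), HENCE DESCENDS TO THE TORUS ONCE IT IS `SU(2)`-VALUED —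
# and then (σ1) of `Prop7ChartSigmaT3.avgCondPrint_of_restrictedAxial_of_eq137cov` HOLDS (route `UnitScaleTilt`, crux K1 «MinimiserStabilityRegPr»
# stmt-QuantumFields-19200, stub `stub_existenceMinimalOrbit`, route (α), (S3)(i) `ChartSigmaT3`; OWNER RULING g25-№3 §3(a); def-free, count-neutral)

Cell `ym3-torus` (HUMAN RULING D-0037, YM ladder rung R3 — YM₃ on T³ is a rung, not d = 4, not a mass gap, not Clay).

WHY.  `Prop7ChartSigmaT3` (p598418) reduced print's (20) in surface form (`Prop7SPrint.AvgCondPrint`) to the equation (1.37)^cov plus (σ1): «for every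
`U₁` there is a (1.29)-restricted torus gauge transformation `u` with `(U₁U₀)^u` in the axial gauge (1.19)».  On `ℤᵈ` (σ1) is PURE ALGEBRA and in the tree:
`B7Eq84Concrete.gaugeFixing_exists` (the explicit `glev`, (77) below the values (87); `axialGauge_glev`, `eq81_glev`; uniqueness `gaugeFixing_unique`).
To read it on the torus one descends `glev` of the BASED PULLBACKS (`Prop7AxialReprPrint.exists_su_gauge_of_periodic`), which needs `glev` (P) PERIODIC with
the period `sitesPerDir 0` of the pullbacks and (S) `SU(2)`-VALUED.  THIS FILE proves (P) — from print's UNIQUENESS p.31 («the gauge transformation is uniquely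
determined by all the conditions») and the translation covariance of every letter of (76)–(87) (the translate of `glev` by a period satisfies the same axial
and averaging conditions for the same periodic data, hence equals `glev`) — and assembles (σ1) and the Σ_k bridge MODULO (S), which stays DISPLAYED
(`hS`; it is the AvgClosed-type closure of the site averages (78)–(85) plus the smallness keeping their logarithms principal — [Balaban1985Averaging] pp.31–32;
not in the tree).

WHAT IS PROVED (sorry-free, no definition; `t_a` = `B12Ineq417Flat.shiftCfg a`):
* §1 translation covariance of the §C letters not yet in `B7TranslationCovariance`: `R0fun_shiftCfg` ((59)), `Sexp_shiftCfg`∕`savg_shiftCfg` ((78)),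
  `R0avg_shiftCfg` ((78)), **`uavg_shiftCfg`** ((79)–(80): `\overline{R₀(t_{Lʲa}u)}ʲ = t_a\overline{R₀u}ʲ` at the translated background), **`tildIter_shiftCfg`** ((69));
* §2 **`axialGauge_shiftCfg`**, **`uavg_top_shiftCfg`** — for data `U₀, U₁` invariant under `t_c`, `c = Lᵏ•a`, the translate `t_c u` of a gauge transformation
  satisfying (67) + (81) satisfies them too; hence **`glev_shiftCfg`**: `t_c (glev L hL U₀ U₁ k 0) = glev L hL U₀ U₁ k 0` (`gaugeFixing_unique`) and
  **`glev_periodic`** (coordinate form);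
* §3 AT THE T³ OBJECTS (`x₀ = Prop7SPrint.basePt F n K`, `k = K − n`, based pullbacks `U♯`): `glev_pull_periodic` (period `sitesPerDir 0`, from
  `B8Thm2SetupTorus.pull_periodic` + `Prop7FlatHolonomy.sitesPerDir_zero_eq_mul_pow`); **`exists_restrictedAxial_of_glev_mem`** — (σ1) ⇐ (S): if `glev` of the
  pullbacks is `SU(2)`-valued it descends to a torus `u` with `RestrictedPrint F n K U₀ u ∧ IsAxialPrint F n K U₀ ((U₁U₀)^u)` (`exists_su_gauge_of_periodic`,
  `eq81_glev` through `B8Eq178Averages.restr129_iff_uavg`, `axialGauge_glev` through `B8Eq131Derivation.ax119_iff_ax67`); and the Σ_k bridge with (S) as its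
  only displayed letter besides (1.37)^cov: **`avgCondPrint_of_glev_mem_of_eq137cov`**.
HONEST FRAMING.  Bookkeeping (finite sums re-indexed under translations; one uniqueness theorem applied); (S) displayed; nothing of print asserted;
`--supports stmt-QuantumFields-19200 --as helper`.

References: T. Bałaban, CMP 98 (1985) 17–51 [Balaban1985Averaging] ((59)–(60) p.27, (67)–(69) p.29, (76)–(81) p.30, (84)–(88) p.31); CMP 99 (1985) 75–102
[Balaban1985RegularSpaces] ((1.3) p.77, (1.19) p.79, (1.29) p.81); CMP 102 (1985) 277–309 [Balaban1985Variational] ((20) p.281, p.299).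
-/

set_option autoImplicit false

noncomputable section

namespace Summit.QuantumFields.YangMills.Theorems.Prop7ChartSigmaT3Descent

open scoped Matrix.Norms.L2Operator
open NormedSpace
open Literature.MathematicalPhysics.QuantumFieldTheory.Balaban1983to89
open B7Prop1Explicit renaming Site → LSite
open B7Prop1Explicit (hol treeWord boxVec e)
open B7Prop2Explicit (avgIter)
open B7Eq92Concrete (Rc mgauge mgauge_mul tHol tildIter tildIter_apply)
open B7Eq99Concrete (R0fun R0fun_apply Sexp Sexp_apply savg savg_apply R0avg)
open B7Eq84Concrete (uavg uavg_zero uavg_succ AxialGauge glev axialGauge_glev eq81_glev gaugeFixing_unique)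
open B7TranslationCovariance (mgauge_shiftCfg tHol_shiftCfg avgIter_shiftCfg shiftCfg_avgIter shiftCfg_mul)
open B12Ineq417Flat (shiftCfg shiftCfg_apply hol_shiftCfg)

/-! ## §1 Translation covariance of the §C letters (59), (78)–(80), (69) -/

section Shift

variable {d : ℕ}

section Group

variable {G : Type*} [Group G]

/-- **(59) is translation covariant**: `R_{0,y}(t_a v)` at `t_aV₀` is `t_a(R_{0,y+a}v)` at `V₀`. [cite: Balaban1985Averaging, p.27 (display after (59))] -/
theorem R0fun_shiftCfg (a : LSite d) (V₀ : LSite d → Fin d → G) (y : LSite d) (v : LSite d → G) :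
    R0fun (shiftCfg a V₀) y (shiftCfg a v) = shiftCfg a (R0fun V₀ (y + a) v) := by
  funext x
  simp only [R0fun_apply, shiftCfg_apply, hol_shiftCfg, add_sub_add_right_eq_sub]

end Group

variable {𝔸 : Type*} [NormedRing 𝔸] [NormedAlgebra ℂ 𝔸] [CompleteSpace 𝔸]

omit [CompleteSpace 𝔸] in
/-- **The exponent of the site average (78) is translation covariant**: `S_{t_a g}(y) = S_g(y + a)`. [cite: Balaban1985Averaging, (78) p.30] -/
theorem Sexp_shiftCfg (L : ℕ) (a : LSite d) (g : LSite d → 𝔸ˣ) (y : LSite d) : Sexp L (shiftCfg a g) y = Sexp L g (y + a) := by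
  simp only [Sexp_apply, shiftCfg_apply, add_right_comm y _ a]

/-- **The site average (78) is translation covariant**: `{t_a g}_{B(y)} = {g}_{B(y+a)}`. [cite: Balaban1985Averaging, (78) p.30] -/
theorem savg_shiftCfg (L : ℕ) (a : LSite d) (g : LSite d → 𝔸ˣ) (y : LSite d) : savg L (shiftCfg a g) y = savg L g (y + a) := by
  rw [savg_apply, savg_apply, Sexp_shiftCfg, shiftCfg_apply]

/-- **The twisted site average (78) is translation covariant**: `\overline{R₀(t_a v)}(y)` at `t_aV₀` `= \overline{R₀v}(y + a)` at `V₀`.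
[cite: Balaban1985Averaging, (78) p.30] -/
theorem R0avg_shiftCfg (L : ℕ) (a : LSite d) (V₀ : LSite d → Fin d → 𝔸ˣ) (v : LSite d → 𝔸ˣ) (y : LSite d) :
    R0avg L (shiftCfg a V₀) (shiftCfg a v) y = R0avg L V₀ v (y + a) := by
  unfold R0avg
  rw [R0fun_shiftCfg, savg_shiftCfg]

/-- **(79)–(80) are translation covariant**: a translation by `a` of the level-`j` lattice is the translation by `Lʲa` of the fine data,
`\overline{R₀(t_{Lʲa}u)}ʲ(z)` at `t_{Lʲa}U₀` `= \overline{R₀u}ʲ(z + a)` at `U₀`. [cite: Balaban1985Averaging, (79)–(80) p.30, (43) p.24] -/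
theorem uavg_shiftCfg (L : ℕ) (U₀ : LSite d → Fin d → 𝔸ˣ) (u : LSite d → 𝔸ˣ) :
    ∀ (j : ℕ) (a z : LSite d),
      uavg L (shiftCfg (((L : ℤ) ^ j) • a) U₀) (shiftCfg (((L : ℤ) ^ j) • a) u) j z = uavg L U₀ u j (z + a)
  | 0, a, z => by simp
  | j + 1, a, z => by
    rw [uavg_succ, uavg_succ, smul_add]
    have hU : avgIter L (shiftCfg (((L : ℤ) ^ (j + 1)) • a) U₀) j = shiftCfg ((L : ℤ) • a) (avgIter L U₀ j) := by
      rw [shiftCfg_avgIter, smul_smul, ← pow_succ]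
    have hu : uavg L (shiftCfg (((L : ℤ) ^ (j + 1)) • a) U₀) (shiftCfg (((L : ℤ) ^ (j + 1)) • a) u) j
        = shiftCfg ((L : ℤ) • a) (uavg L U₀ u j) := by
      funext x
      rw [shiftCfg_apply, ← uavg_shiftCfg L U₀ u j ((L : ℤ) • a) x, smul_smul, ← pow_succ]
    rw [hU, hu, R0avg_shiftCfg]

/-- **(69) is translation covariant**: `Ũ′ʲ(z + a)` for `(U₀, U₁)` `=` `Ũ′ʲ(z)` for `(t_{Lʲa}U₀, t_{Lʲa}U₁)`. [cite: Balaban1985Averaging, (69) p.29, (43) p.24] -/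
theorem tildIter_shiftCfg (L : ℕ) (U₀ U₁ : LSite d → Fin d → 𝔸ˣ) (j : ℕ) (a z : LSite d) (κ : Fin d) :
    tildIter L (shiftCfg (((L : ℤ) ^ j) • a) U₀) (shiftCfg (((L : ℤ) ^ j) • a) U₁) j z κ = tildIter L U₀ U₁ j (z + a) κ := by
  rw [tildIter_apply, tildIter_apply, ← shiftCfg_mul, ← avgIter_shiftCfg, ← avgIter_shiftCfg]

/-! ## §2 The translate of an (81)-normalised axial gauge fixing is one; `glev` is translation invariant for invariant data -/

/-- **(67) is translation covariant**: if `U₀, U₁` are invariant under `t_c`, `c = Lᵏ•a`, and `U₁^u` satisfies the block axial gauge conditions (67) at the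
levels `j < k`, so does `U₁^{t_c u}` (the condition at the block `Lz` for `t_c u` is the condition at the block `L(z + L^{k−j−1}a)` for `u`).
[cite: Balaban1985Averaging, (67) p.29, (55) p.27] -/
theorem axialGauge_shiftCfg (L : ℕ) (U₀ U₁ : LSite d → Fin d → 𝔸ˣ) (u : LSite d → 𝔸ˣ) (k : ℕ) (a : LSite d)
    (hU₀ : shiftCfg (((L : ℤ) ^ k) • a) U₀ = U₀) (hU₁ : shiftCfg (((L : ℤ) ^ k) • a) U₁ = U₁) (hax : AxialGauge L U₀ U₁ u k) :
    AxialGauge L U₀ U₁ (shiftCfg (((L : ℤ) ^ k) • a) u) k := by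
  intro j hj z r
  have hkj : k = j + 1 + (k - j - 1) := by omega
  -- the level-`j` translation vector `b = L • L^{k−j−1} • a` rescales to `Lᵏ • a` on the fine lattice
  have e1 : ((L : ℤ) ^ j) • ((L : ℤ) • (((L : ℤ) ^ (k - j - 1)) • a)) = ((L : ℤ) ^ k) • a := by
    rw [smul_smul, smul_smul, ← pow_succ, ← pow_add, ← hkj]
  have hB0 : shiftCfg (((L : ℤ) ^ j) • ((L : ℤ) • (((L : ℤ) ^ (k - j - 1)) • a))) U₀ = U₀ := by rw [e1]; exact hU₀
  have hM : mgauge U₀ (shiftCfg (((L : ℤ) ^ k) • a) u) U₁ = shiftCfg (((L : ℤ) ^ j) • ((L : ℤ) • (((L : ℤ) ^ (k - j - 1)) • a)))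
      (mgauge U₀ u U₁) := by
    rw [e1]
    conv_lhs => rw [← hU₀, ← hU₁]
    exact mgauge_shiftCfg _ _ _ _
  have hB : avgIter L U₀ j = shiftCfg ((L : ℤ) • (((L : ℤ) ^ (k - j - 1)) • a)) (avgIter L U₀ j) := by
    rw [shiftCfg_avgIter, hB0]
  have hT : tildIter L U₀ (mgauge U₀ (shiftCfg (((L : ℤ) ^ k) • a) u) U₁) j
      = shiftCfg ((L : ℤ) • (((L : ℤ) ^ (k - j - 1)) • a)) (tildIter L U₀ (mgauge U₀ u U₁) j) := by
    funext x κ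
    rw [hM, shiftCfg_apply, ← tildIter_shiftCfg L U₀ (mgauge U₀ u U₁) j _ x κ, hB0]
  rw [hT, hB, tHol_shiftCfg, ← smul_add]
  exact hax j hj (z + ((L : ℤ) ^ (k - j - 1)) • a) r

/-- **(81) is translation covariant**: for `t_c`-invariant `U₀` (`c = Lᵏ•a`), `\overline{R₀(t_c u)}ᵏ(z) = \overline{R₀u}ᵏ(z + a)`; so (81) for `u` gives (81)
for `t_c u`. [cite: Balaban1985Averaging, (81) p.30] -/
theorem uavg_top_shiftCfg (L : ℕ) (U₀ : LSite d → Fin d → 𝔸ˣ) (u : LSite d → 𝔸ˣ) (k : ℕ) (a : LSite d)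
    (hU₀ : shiftCfg (((L : ℤ) ^ k) • a) U₀ = U₀) (z : LSite d) :
    uavg L U₀ (shiftCfg (((L : ℤ) ^ k) • a) u) k z = uavg L U₀ u k (z + a) := by
  conv_lhs => rw [← hU₀]
  exact uavg_shiftCfg L U₀ u k a z

/-- **`glev` IS TRANSLATION INVARIANT FOR INVARIANT DATA** (print p.31 «the gauge transformation is uniquely determined by all the conditions»): for `U₀, U₁`
invariant under `t_c`, `c = Lᵏ•a`, the translate `t_c glev` satisfies (67) + (81) (§2), hence equals `glev` (`B7Eq84Concrete.gaugeFixing_unique`).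
[cite: Balaban1985Averaging, (76)–(81) p.30, (86)–(87) p.31] -/
theorem glev_shiftCfg (L : ℕ) (hL : 1 ≤ L) (U₀ U₁ : LSite d → Fin d → 𝔸ˣ) (k : ℕ) (a : LSite d)
    (hU₀ : shiftCfg (((L : ℤ) ^ k) • a) U₀ = U₀) (hU₁ : shiftCfg (((L : ℤ) ^ k) • a) U₁ = U₁) :
    shiftCfg (((L : ℤ) ^ k) • a) (glev L hL U₀ U₁ k 0) = glev L hL U₀ U₁ k 0 :=
  gaugeFixing_unique L hL U₀ U₁ k
    (axialGauge_shiftCfg L U₀ U₁ _ k a hU₀ hU₁ (axialGauge_glev L hL U₀ U₁ k))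
    (fun z => by rw [uavg_top_shiftCfg L U₀ _ k a hU₀ z]; exact eq81_glev L hL U₀ U₁ k _)
    (axialGauge_glev L hL U₀ U₁ k) (eq81_glev L hL U₀ U₁ k)

/-- **`glev` OF PERIODIC DATA IS PERIODIC** (coordinate form): if `U₀, U₁` are `N·Lᵏ`-periodic in direction `i`, so is `glev L hL U₀ U₁ k 0` — the (81)-normalised
axial gauge of a configuration on the torus ([Balaban1985RegularSpaces] (1.3)) read on `ℤᵈ`. [cite: Balaban1985Averaging, (77)–(87) pp.30–31; Balaban1985RegularSpaces, (1.3) p.77] -/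
theorem glev_periodic (L : ℕ) (hL : 1 ≤ L) (U₀ U₁ : LSite d → Fin d → 𝔸ˣ) (k N : ℕ) (i : Fin d)
    (hU₀ : shiftCfg (((N * L ^ k : ℕ) : ℤ) • e i) U₀ = U₀) (hU₁ : shiftCfg (((N * L ^ k : ℕ) : ℤ) • e i) U₁ = U₁) (x : LSite d) :
    glev L hL U₀ U₁ k 0 (x + (((N * L ^ k : ℕ) : ℤ)) • e i) = glev L hL U₀ U₁ k 0 x := by
  have hc : (((N * L ^ k : ℕ) : ℤ)) • (e i : LSite d) = ((L : ℤ) ^ k) • (((N : ℤ)) • e i) := by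
    rw [smul_smul]; congr 1; push_cast; ring
  rw [hc] at hU₀ hU₁ ⊢
  have h := congrFun (glev_shiftCfg L hL U₀ U₁ k _ hU₀ hU₁) x
  rwa [shiftCfg_apply] at h

end Shift

/-! ## §3 At the T³ objects: `glev` of the based pullbacks is periodic; (σ1) and the Σ_k bridge modulo (S) -/

section T3

open Literature.MathematicalPhysics.QuantumFieldTheory.Balaban1983to89.T3ContinuumYM3Torus
open Literature.MathematicalPhysics.QuantumFieldTheory.Balaban1983to89.T3LevelShift (siteShift)
open Literature.MathematicalPhysics.QuantumFieldTheory.Balaban1983to89.T3UnitLawDensityEML (ℰp)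
open Literature.MathematicalPhysics.QuantumFieldTheory.Balaban1983to89.T3TiltDescent (descendTo)
open Literature.MathematicalPhysics.QuantumFieldTheory.Balaban1983to89.T3PrintedRegularOrbits (sites_eq)
open B7Prop2SpecialUnitary (specialUnitaryUnits)
open B7Eq99Concrete (wrec)
open B8Eq119TwistedAxial (InAx Restr129)
open B8Eq131Derivation (ax119_iff_ax67)
open B8Eq178Averages (restr129_iff_uavg)
open B8Thm4TorusAt (torusLam mem_torusLam_iff)
open B10Eq27TorusAxialLog (pull unitsField toUField)
open B8Thm2SetupTorus (pullGauge toUGauge pull_periodic)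
open T3SectALandauChart (emb15)
open Summit.QuantumFields.YangMills.Theorems.Prop7SPrint (basePt IsAxialPrint RestrictedPrint AvgCondPrint)
open Summit.QuantumFields.YangMills.Theorems.Prop7AxialReprPrint (exists_su_gauge_of_periodic pull_toUField_gaugeAct)
open Summit.QuantumFields.YangMills.Theorems.Prop7FlatHolonomy (sitesPerDir_zero_eq_mul_pow)
open Summit.QuantumFields.YangMills.Theorems.Prop7ChartSigmaT3 (pull_emb15 avgCondPrint_of_restrictedAxial_of_eq137cov_canonical)

variable (F : T3Family) {n K : ℕ} (h : n ≤ K)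

/-- **`glev` OF THE BASED PULLBACKS IS PERIODIC WITH THE TORUS PERIOD** `sitesPerDir 0 = N_k·Lᵏ` (`pull_periodic` + `sitesPerDir_zero_eq_mul_pow` + §2) —
the `hper` letter of `Prop7AxialReprPrint.exists_su_gauge_of_periodic`. [cite: Balaban1985RegularSpaces, (1.3) p.77; Balaban1985Averaging, (77)–(87) pp.30–31] -/
theorem glev_pull_periodic (hL : 1 ≤ (F.P K).L) (U₀ U₁ : GaugeField (F.P K) 0 (Matrix.specialUnitaryGroup (Fin 2) ℂ))
    (x₀ : Site (F.P K) 0) (z : LSite (F.P K).d) (i : Fin (F.P K).d) :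
    glev (F.P K).L hL (pull (unitsField (toUField U₀)) x₀) (pull (unitsField (toUField U₁)) x₀) (K - n) 0
        (z + (((F.P K).sitesPerDir 0 : ℕ) : ℤ) • e i)
      = glev (F.P K).L hL (pull (unitsField (toUField U₀)) x₀) (pull (unitsField (toUField U₁)) x₀) (K - n) 0 z := by
  have hk : K - n ≤ (F.P K).m + (F.P K).K := by show K - n ≤ F.m + K; omega
  have hN : (F.P K).sitesPerDir 0 = (F.P K).sitesPerDir (K - n) * (F.P K).L ^ (K - n) := sitesPerDir_zero_eq_mul_pow hk
  have h₀ := pull_periodic (unitsField (toUField U₀)) x₀ i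
  have h₁ := pull_periodic (unitsField (toUField U₁)) x₀ i
  rw [hN] at h₀ h₁ ⊢
  exact glev_periodic (F.P K).L hL _ _ (K - n) ((F.P K).sitesPerDir (K - n)) i h₀ h₁ z

/-- **(σ1) MODULO (S)**: if the (81)-normalised axial gauge fixing `glev` ([Balaban1985Averaging] (77) + (87)) of the based pullbacks `U₀♯, U₁♯` is `SU(2)`-VALUED
(the displayed letter `hS`), then it descends to a torus gauge transformation `u` (periodicity §3 + `exists_su_gauge_of_periodic`) which is (1.29)-RESTRICTED relative to
`U₀` (`RestrictedPrint`, from (81) `eq81_glev`) and carries `U₁U₀` into the AXIAL GAUGE (1.19) (`IsAxialPrint`, from (67) `axialGauge_glev`) — print p.299 «we apply to it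
a gauge transformation u satisfying R̄₀u = 1 on Λ_j and such that (U₁U₀)^u satisfies the axial gauge conditions».
[cite: Balaban1985Variational, p.299; Balaban1985Averaging, (77)–(81) p.30, (87) p.31; Balaban1985RegularSpaces, (1.19) p.79, (1.29) p.81] -/
theorem exists_restrictedAxial_of_glev_mem (hL : 1 ≤ (F.P K).L) (U₀ U₁ : GaugeField (F.P K) 0 (Matrix.specialUnitaryGroup (Fin 2) ℂ))
    (hS : ∀ z, glev (F.P K).L hL (pull (unitsField (toUField U₀)) (basePt F n K)) (pull (unitsField (toUField U₁)) (basePt F n K)) (K - n) 0 z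
      ∈ specialUnitaryUnits (Fin 2)) :
    ∃ u : GaugeTransf (F.P K) 0 (Matrix.specialUnitaryGroup (Fin 2) ℂ),
      RestrictedPrint F n K U₀ u ∧ IsAxialPrint F n K U₀ (GaugeField.gaugeAct u (emb15 U₀ U₁)) := by
  obtain ⟨v, hv⟩ := exists_su_gauge_of_periodic hS (fun z i => glev_pull_periodic F hL U₀ U₁ (basePt F n K) z i) (basePt F n K)
  refine ⟨v, ?_, ?_⟩
  · show Restr129 (F.P K).L (K - n) (torusLam (K - n)) (pull (unitsField (toUField U₀)) (basePt F n K))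
      (pullGauge (fun x => Unitary.toUnits (toUGauge (F.P K) 2 v x)) (basePt F n K))
    rw [hv, restr129_iff_uavg]
    intro j _ y hy
    rw [mem_torusLam_iff] at hy
    subst hy
    exact eq81_glev _ hL _ _ _ y
  · show InAx (F.P K).L (K - n) (torusLam (K - n)) (pull (unitsField (toUField U₀)) (basePt F n K))
      (pull (unitsField (toUField (GaugeField.gaugeAct v (emb15 U₀ U₁)))) (basePt F n K))
    rw [pull_toUField_gaugeAct, pull_emb15, ← mgauge_mul, hv]
    intro j _ hjk xj _ m hm z _ r
    exact (ax119_iff_ax67 _ _ _ m z r).2 (axialGauge_glev _ hL _ _ (K - n) m (by omega) z r)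

/-- **THE Σ_k BRIDGE WITH (S) AS THE ONLY DISPLAYED LETTER BESIDE (1.37)^cov**: `Prop7SPrint.AvgCondPrint F n K h V U₀ X` from (S) «`glev` of the based pullbacks of
`U₀` and `U₁ = e^{iX}` is `SU(2)`-valued» and the equation (1.37)^cov for `D_{n,K}(U₁U₀)` (`Prop7ChartSigmaT3.avgCondPrint_of_restrictedAxial_of_eq137cov_canonical` ∘
`exists_restrictedAxial_of_glev_mem`). [cite: Balaban1985Variational, (20) p.281, p.299; Balaban1985RegularSpaces, (1.28)–(1.31) pp.81–82] -/
theorem avgCondPrint_of_glev_mem_of_eq137cov (hL : 1 ≤ (F.P K).L) (V : GaugeField (F.P n) 0 (Matrix.specialUnitaryGroup (Fin 2) ℂ))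
    (U₀ : GaugeField (F.P K) 0 (Matrix.specialUnitaryGroup (Fin 2) ℂ)) (X : PBond (F.P K) 0 → Matrix (Fin 2) (Fin 2) ℂ)
    (hS : ∀ U₁ : GaugeField (F.P K) 0 (Matrix.specialUnitaryGroup (Fin 2) ℂ),
      (∀ b : PBond (F.P K) 0, ((U₁ b : Matrix.specialUnitaryGroup (Fin 2) ℂ) : Matrix (Fin 2) (Fin 2) ℂ) = exp (Complex.I • X b)) →
        ∀ z, glev (F.P K).L hL (pull (unitsField (toUField U₀)) (basePt F n K)) (pull (unitsField (toUField U₁)) (basePt F n K)) (K - n) 0 z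
          ∈ specialUnitaryUnits (Fin 2))
    (h137 : ∀ U₁ : GaugeField (F.P K) 0 (Matrix.specialUnitaryGroup (Fin 2) ℂ),
      (∀ b : PBond (F.P K) 0, ((U₁ b : Matrix.specialUnitaryGroup (Fin 2) ℂ) : Matrix (Fin 2) (Fin 2) ℂ) = exp (Complex.I • X b)) →
        ∀ c : PBond (F.P n) 0,
          unitsField (toUField (descendTo F ℰp n K h (emb15 U₀ U₁))) c
            = wrec (F.P K).L (pull (unitsField (toUField U₀)) (basePt F n K)) (pull (unitsField (toUField U₁)) (basePt F n K)) (K - n)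
                (fun μ => (((siteShift (sites_eq F n K h) c.src) μ).val : ℤ))
              * unitsField (toUField V) c
              * (wrec (F.P K).L (pull (unitsField (toUField U₀)) (basePt F n K)) (pull (unitsField (toUField U₁)) (basePt F n K)) (K - n)
                (fun μ => (((siteShift (sites_eq F n K h) c.tgt) μ).val : ℤ)))⁻¹) :
    AvgCondPrint F n K h V U₀ X :=
  avgCondPrint_of_restrictedAxial_of_eq137cov_canonical F h V U₀ X
    (fun U₁ hU₁ => exists_restrictedAxial_of_glev_mem F hL U₀ U₁ (hS U₁ hU₁)) h137

end T3

end Summit.QuantumFields.YangMills.Theorems.Prop7ChartSigmaT3Descent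

end
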